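import Mathlib.Data.Finset.Card
import Mathlib.Data.Finset.Range
import HarnessLib

/-!
# Davenport–Schinzel sequences of order 2: an `abab`-free sequence over `s` changes value at most `2 |s| - 2` times

Crux `SAWLeftRightFKG.FKGToTraversalBound` (stmt-CriticalPhenomena-1878), line `slit-necklace`, witness unit
U2-count of the planar-witness stub `stub_necklaceWitnessFarU` (lead prover-line-stmt-CriticalPhenomena-1878-c5-0).

Pure combinatorics, Mathlib only.  A sequence `f 0, f 1, …, f L` with values in a finite set `s` is
`abab`-*free* when there are no indices `a < b < c < d ≤ L` with `f a = f c ≠ f b = f d` (an alternation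
`x … y … x … y` of two distinct symbols, not necessarily contiguous).  The classical bound
`λ₂(n) = 2 n - 1` on the length of Davenport–Schinzel sequences of order `2` says that such a sequence has at
most `2 |s| - 1` maximal constant runs, i.e. at most `2 |s| - 2` *changes* `#{k < L | f k ≠ f (k + 1)}`.

Proof (a charging argument, no induction).  Split the changes `k` (`f k ≠ f (k + 1)`) into
* *first entries*: `k + 1` is the first occurrence of its value.  Then `k ↦ f (k + 1)` is injective on these
  and avoids `f 0` (which first occurs at `0`): at most `|s| - 1` of them;
* *returns*: the value `f (k + 1)` already occurred at some `j ≤ k` (so `j < k`).  Then `k` is the LAST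
  occurrence of `u := f k`: a later occurrence `f m = u`, `m > k + 1`, would give the alternation
  `f j, f k, f (k + 1), f m = v u v u`; and `m = k + 1` is excluded by `f k ≠ f (k + 1)`.  Hence `k ↦ f k` is
  injective on returns and avoids `f L` (whose last occurrence is `L > k`): at most `|s| - 1` of them.
Together with `|s| ≥ 1` (`f 0 ∈ s`) this is `changes + 2 ≤ 2 |s|`.

Folklore (Davenport–Schinzel 1965, the case `s = 2`); only theorems; axioms are the standard three.
-/

noncomputable section

namespace Summit.CriticalPhenomena.SAWScalingLimit.Theorems.FKGToTraversalBound.SlitNecklace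

/-- **Davenport–Schinzel, order 2** (witness unit U2-count).  If `f 0, …, f L` takes values in the finite
set `s` and contains no alternation `a < b < c < d ≤ L`, `f a = f c`, `f b = f d`, `f a ≠ f b`, then the number
of value changes `#{k < L | f k ≠ f (k + 1)}` is at most `2 |s| - 2`, stated subtraction-free as
`changes + 2 ≤ 2 |s|` (note `|s| ≥ 1` since `f 0 ∈ s`). -/
theorem card_changes_le_of_abab_free : ∀ {α : Type*} [DecidableEq α] (f : ℕ → α) (L : ℕ) (s : Finset α), (∀ k, k ≤ L → f k ∈ s) → (¬ ∃ a b c d : ℕ, a < b ∧ b < c ∧ c < d ∧ d ≤ L ∧ f a = f c ∧ f b = f d ∧ f a ≠ f b) → ((Finset.range L).filter (fun k => f k ≠ f (k + 1))).card + 2 ≤ 2 * s.card := by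
  intro α _ f L s hs hfree
  classical
  set C : Finset ℕ := (Finset.range L).filter (fun k => f k ≠ f (k + 1)) with hC
  -- membership in the set of changes
  have memC : ∀ {k : ℕ}, k ∈ C → k < L ∧ f k ≠ f (k + 1) := fun hk => by
    simpa [hC, Finset.mem_filter, Finset.mem_range] using hk
  -- `P k`: the index `k + 1` is the first occurrence of its value
  let P : ℕ → Prop := fun k => ∀ j, j ≤ k → f j ≠ f (k + 1)
  -- key: a "return" change `k` is the last occurrence of `f k`
  have key : ∀ k m : ℕ, f k ≠ f (k + 1) → (∃ j, j ≤ k ∧ f j = f (k + 1)) → k < m → m ≤ L →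
      f k ≠ f m := by
    rintro k m hk ⟨j, hj, hjv⟩ hkm hmL heq
    have hjk : j < k := lt_of_le_of_ne hj (by rintro rfl; exact hk hjv)
    rcases Nat.lt_or_ge (k + 1) m with h | h
    · exact hfree ⟨j, k, k + 1, m, hjk, Nat.lt_succ_self k, h, hmL, hjv, heq, by rw [hjv]; exact hk.symm⟩
    · obtain rfl : m = k + 1 := le_antisymm h hkm
      exact hk heq
  have h0 : f 0 ∈ s := hs 0 (Nat.zero_le L)
  have hL : f L ∈ s := hs L le_rfl
  -- first entries inject into `s \ {f 0}` via `k ↦ f (k + 1)`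
  have h1 : (C.filter P).card ≤ (s.erase (f 0)).card := by
    apply Finset.card_le_card_of_injOn (fun k => f (k + 1))
    · intro k hk
      rw [Finset.coe_filter] at hk
      obtain ⟨hkC, hPk⟩ := hk
      obtain ⟨hkL, -⟩ := memC hkC
      rw [Finset.mem_coe, Finset.mem_erase]
      exact ⟨(hPk 0 (Nat.zero_le k)).symm, hs (k + 1) hkL⟩
    · intro k₁ hk₁ k₂ hk₂ heq
      rw [Finset.coe_filter] at hk₁ hk₂
      obtain ⟨-, hP₁⟩ := hk₁
      obtain ⟨-, hP₂⟩ := hk₂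
      rcases lt_trichotomy k₁ k₂ with h | h | h
      · exact absurd heq (hP₂ (k₁ + 1) h)
      · exact h
      · exact absurd heq.symm (hP₁ (k₂ + 1) h)
  -- returns inject into `s \ {f L}` via `k ↦ f k`
  have h2 : (C.filter (fun k => ¬ P k)).card ≤ (s.erase (f L)).card := by
    apply Finset.card_le_card_of_injOn (fun k => f k)
    · intro k hk
      rw [Finset.coe_filter] at hk
      obtain ⟨hkC, hPk⟩ := hk
      obtain ⟨hkL, hk⟩ := memC hkC
      have hret : ∃ j, j ≤ k ∧ f j = f (k + 1) := by
        by_contra hcon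
        exact hPk (fun j hj hjv => hcon ⟨j, hj, hjv⟩)
      rw [Finset.mem_coe, Finset.mem_erase]
      exact ⟨key k L hk hret hkL le_rfl, hs k hkL.le⟩
    · intro k₁ hk₁ k₂ hk₂ heq
      rw [Finset.coe_filter] at hk₁ hk₂
      obtain ⟨hC₁, hP₁⟩ := hk₁
      obtain ⟨hC₂, hP₂⟩ := hk₂
      obtain ⟨hL₁, hne₁⟩ := memC hC₁
      obtain ⟨hL₂, hne₂⟩ := memC hC₂
      have hret₁ : ∃ j, j ≤ k₁ ∧ f j = f (k₁ + 1) := by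
        by_contra hcon
        exact hP₁ (fun j hj hjv => hcon ⟨j, hj, hjv⟩)
      have hret₂ : ∃ j, j ≤ k₂ ∧ f j = f (k₂ + 1) := by
        by_contra hcon
        exact hP₂ (fun j hj hjv => hcon ⟨j, hj, hjv⟩)
      rcases lt_trichotomy k₁ k₂ with h | h | h
      · exact absurd heq (key k₁ k₂ hne₁ hret₁ h hL₂.le)
      · exact h
      · exact absurd heq.symm (key k₂ k₁ hne₂ hret₂ h hL₁.le)
  have hsplit : (C.filter P).card + (C.filter (fun k => ¬ P k)).card = C.card :=
    Finset.card_filter_add_card_filter_not P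
  rw [Finset.card_erase_of_mem h0] at h1
  rw [Finset.card_erase_of_mem hL] at h2
  have hpos : 0 < s.card := Finset.card_pos.mpr ⟨_, h0⟩
  omega

end Summit.CriticalPhenomena.SAWScalingLimit.Theorems.FKGToTraversalBound.SlitNecklace

end
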